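import Summits.BirchSwinnertonDyer.BirchSwinnertonDyer.Theorems.PrintCf2SplitBadTwoF3LevelLift
import Summits.BirchSwinnertonDyer.BirchSwinnertonDyer.Theorems.PrintCf2SplitBadTwoRestrictedSelmerRelaxedSummandExponent
import Summits.BirchSwinnertonDyer.BirchSwinnertonDyer.Theorems.PrintCf2SplitBadTwoLevelEigenSplitting
import Summits.BirchSwinnertonDyer.BirchSwinnertonDyer.Theorems.PrintCf2SplitBadTwoAdditiveAtSeven
import Summits.BirchSwinnertonDyer.BirchSwinnertonDyer.Theorems.PrintCf2SplitBadTwoCMPrimaryConjugationTransport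
import HarnessLib

/-!
# Crux `PrintCf2.SplitBadTwoRankOneOfFacts` (stmt-BirchSwinnertonDyer-20368), road α v10.3, S3c residual (F3), piece (P1) — INPUTS of the level lift:
# the killing exponent of `𝔖_v̄(K, W*)` and the canonical e-relaxed torsion structure (OPTION A‴)

Cell `bsd-print-cf2`, EXTRA WIDTH seat `bsd-line-cf2-p1-w5` g3; `--supports stmt-BirchSwinnertonDyer-20368` (helper, Theses-free). HONEST FRAMING:
nothing here closes the crux or a registered stub; BSD is not proved by any of this; no summit statement is proved by this seat. No definition,
no named fact, no `sorry`, no kit. beyond-print theorem: no.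
* `exists_forall_pow_nsmul_restrictedSelmerBase_eq_zero` — `Finite 𝔖_𝔮(K, W*)` ⟹ `∃ N₀ ≥ 1, ∀ N ≥ N₀, p^N · 𝔖_𝔮(K, W*) = 0` (hypothesis `hN` of
  p677230 `relIndex_selmerGroup_update_top_eq_natCard_range_resOfLe`; transport to `H¹(Γ_K, W*)` and p673497's uniform exponent).
* `exists_selmerStructure_relaxedAt` — the OPTION A‴ structure EXISTS: `𝓕 (inl _) = ⊤`, `𝓕 (inr w) = ker(H¹(K_w, E[p^N]) → H¹(K_w, E[p^∞]))`
  (`w ≠ v`), `𝓕 (inr v) = H¹(eN)⁻¹(that kernel)` (hypotheses `h𝓕inf`, `h𝓕`, `h𝓕v` of p677230 and `h𝓕` of p675947).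
* `exists_relIndex_selmerGroup_eq_natCard_range_resOfLe` — the two combined with p677230: for `N ≥ N₀` and every level-`N` shadow `eN` of `e`
  there is such an `𝓕` with `[H¹_{𝓕[v ↦ ⊤]} : H¹_𝓕] = #range(res_{D_v}|𝔖_v̄(K, W*))`.
* `exists_relIndex_selmerGroup_eq_natCard_range_resOfLe_of_frame` — ROAD α: on every S3c frame (`d, W, C, K` imaginary quadratic, `v ≠ v̄ ∣ 2`,
  `π, r`, `W* = E[𝔮_r^∞]`, `Finite 𝔖_v̄(K, W*)`) the CM projector `e` (-w7 g2 `exists_eigenProjector_two`), a threshold `N₀`, and for every `N ≥ N₀`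
  the level shadow `eN` (p669287 `exists_levelProj`, all five properties exported) and the OPTION A‴ structure `𝓕` with the (P1) identity.
References: [GreenbergLNM1716] §2, §5 proof of Prop. 5.8; [MazurRubin2004] Def. 2.1.1; [Agboola2007] §3, §6; [Rubin1999] §2.
-/

noncomputable section

open scoped Classical

set_option linter.dupNamespace false
set_option autoImplicit false

open CategoryTheory Function Field NumberField IsDedekindDomain WeierstrassCurve
open Literature.NumberTheory.EllipticCurves Literature.NumberTheory.EllipticCurves.GreenbergSelmer
open Literature.NumberTheory.EllipticCurves.Agboola2007
open Literature.NumberTheory.GaloisRepresentations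
open Literature.NumberTheory.GaloisRepresentations.DiscreteGaloisModule (SelmerStructure)
open Literature.NumberTheory.GaloisCohomology
open scoped ContRepresentation
open Summit.BirchSwinnertonDyer.Rank1Residual.X11b
open Summit.BirchSwinnertonDyer.Rank1Residual.X11b.LocBridge
open Summit.BirchSwinnertonDyer.Rank1Residual.X11b.Levels
open Summit.BirchSwinnertonDyer.Rank1Residual.X11b.AcSelmer
open Summit.BirchSwinnertonDyer.Rank1Residual.X11b.Coinv
open Summit.BirchSwinnertonDyer.BirchSwinnertonDyer.Theorems.PrintCf2
open Summit.BirchSwinnertonDyer.BirchSwinnertonDyer.Theorems.PrintCf2.LevelEigen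
open Summit.BirchSwinnertonDyer.BirchSwinnertonDyer.Theorems.PrintCf2.RelaxedExponent
open Summit.BirchSwinnertonDyer.BirchSwinnertonDyer.Theorems.PrintCf2.AdditiveAtSeven

universe u

namespace Summit.BirchSwinnertonDyer.BirchSwinnertonDyer.Theorems.PrintCf2.RestrictedSelmerPair

section Inputs

variable {K : Type} [Field K] [NumberField K] (V : WeierstrassCurve K) [V.IsElliptic] (p : ℕ) [Fact p.Prime]
  (π : V.endRing) (r : ℤ_[p]) (N : ℕ)

omit [V.IsElliptic] in
/-- **The killing exponent of a finite `𝔖_𝔮(K, W*)`**: `∃ N₀ ≥ 1, ∀ N ≥ N₀, ∀ y ∈ 𝔖_𝔮(K, W*), p^N · y = 0` (`W*` is `p`-primary, so every class of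
`H¹(Γ_K, W*)` is killed by a power of `p`; take the maximum over the finite group, transported along `res_{Γ_K → ⊤}`).
[cite: GreenbergLNM1716, §2] [cite: SerreGaloisCohomology1997, I §2.2] -/
theorem exists_forall_pow_nsmul_restrictedSelmerBase_eq_zero (𝔮 : HeightOneSpectrum (𝓞 K))
    (hfin : Finite (restrictedSelmerBase ↥(V.endEigenPrimaryTorsion p π r) p 𝔮)) :
    ∃ N₀ : ℕ, 1 ≤ N₀ ∧ ∀ N : ℕ, N₀ ≤ N → ∀ y ∈ restrictedSelmerBase ↥(V.endEigenPrimaryTorsion p π r) p 𝔮, p ^ N • y = 0 := by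
  have hbij := bijective_resH1Hom_subgroupIncl ↥(V.endEigenPrimaryTorsion p π r) (⊤ : Subgroup (absoluteGaloisGroup K)) Subgroup.mem_top
  set T := resH1Hom (Literature.NumberTheory.EllipticCurves.subgroupIncl (⊤ : Subgroup (absoluteGaloisGroup K)))
    (AddMonoidHom.id ↥(V.endEigenPrimaryTorsion p π r)) (fun _ _ ↦ rfl) with hT
  -- the preimage of `𝔖_𝔮(K, W*)` in `H¹(Γ_K, W*) = H¹(K, W*)`
  let S : AddSubgroup (galoisCohomology (ofSMul ↥(V.endEigenPrimaryTorsion p π r) (isOpen_setOf_smul_eq_summand V p π r)) 1) :=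
    (restrictedSelmerBase ↥(V.endEigenPrimaryTorsion p π r) p 𝔮).comap T
  haveI : Finite S := Finite.of_injective
    (fun s : S ↦ (⟨T (s.1 : discreteH1 (absoluteGaloisGroup K) ↥(V.endEigenPrimaryTorsion p π r)), s.2⟩ :
      restrictedSelmerBase ↥(V.endEigenPrimaryTorsion p π r) p 𝔮))
    (fun a b h ↦ Subtype.ext (hbij.injective (congrArg Subtype.val h)))
  obtain ⟨N₀, h1, hN₀⟩ := exists_pow_nsmul_eq_zero_of_finite_of_primary
    (ρ₁ := ofSMul ↥(V.endEigenPrimaryTorsion p π r) (isOpen_setOf_smul_eq_summand V p π r))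
    (exists_pow_smul_endEigenPrimaryTorsion_eq_zero V p π r) S
  refine ⟨N₀, h1, fun N hN y hy ↦ ?_⟩
  obtain ⟨y', rfl⟩ := hbij.surjective y
  have h0 : p ^ N₀ • y' = 0 := hN₀ y' hy
  obtain ⟨d, rfl⟩ := Nat.exists_eq_add_of_le hN
  rw [← map_nsmul, pow_add, mul_comm, mul_smul, h0, smul_zero, map_zero]

omit [V.IsElliptic] [Fact (Nat.Prime p)] in
/-- **The OPTION A‴ torsion structure exists**: `⊤` at infinity, the propagated zero condition `ker(H¹(K_w, E[p^N]) → H¹(K_w, E[p^∞]))` at every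
finite `w ≠ v`, and its `H¹(eN)`-preimage (the e-relaxed condition `L_v`) at `v`. [cite: MazurRubin2004, Def. 2.1.1]
[cite: GreenbergLNM1716, §5 proof of Prop. 5.8] -/
theorem exists_selmerStructure_relaxedAt (v : HeightOneSpectrum (𝓞 K))
    (eN : (V.torsionGaloisModule ((p ^ N : ℕ) : ℤ)).toContRepresentation →ⁱL (V.torsionGaloisModule ((p ^ N : ℕ) : ℤ)).toContRepresentation) :
    ∃ 𝓕 : SelmerStructure (V.torsionGaloisModule ((p ^ N : ℕ) : ℤ)),
      (∀ w : InfinitePlace K, 𝓕 (Sum.inl w) = ⊤) ∧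
      (∀ w : HeightOneSpectrum (𝓞 K), w ≠ v →
        𝓕 (Sum.inr w) = (galoisCohomology.map ((primaryInclusion V p N).restrictField (w.adicCompletion K)) 1).ker) ∧
      𝓕 (Sum.inr v) = ((galoisCohomology.map ((primaryInclusion V p N).restrictField (v.adicCompletion K)) 1).ker).comap
        (galoisCohomology.map (eN.restrictField (v.adicCompletion K)) 1) := by
  classical
  refine ⟨fun pl ↦ match pl with
      | Sum.inl _ => ⊤
      | Sum.inr w => if w = v then
          (((galoisCohomology.map ((primaryInclusion V p N).restrictField (w.adicCompletion K)) 1).ker).comap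
            (galoisCohomology.map (eN.restrictField (w.adicCompletion K)) 1))
        else (galoisCohomology.map ((primaryInclusion V p N).restrictField (w.adicCompletion K)) 1).ker,
    fun _ ↦ rfl, fun w hw ↦ ?_, ?_⟩
  · exact if_neg hw
  · exact if_pos rfl

/-- **(P1)-LIFT, self-contained form.** `K` totally complex with places above `p` exactly `v ≠ v̄`, `W* = V.endEigenPrimaryTorsion p π r` with an
equivariant projector `e` (`e ∘ ι = id`) and `𝔖_v̄(K, W*)` finite: there is `N₀ ≥ 1` such that for every `N ≥ N₀` and every level-`N` shadow `eN`
of `e` some torsion structure `𝓕` with `⊤` at infinity, the propagated zero condition off `v` and the e-relaxed condition at `v` has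
`[H¹_{𝓕[v ↦ ⊤]}(K, E[p^N]) : H¹_𝓕(K, E[p^N])] = #range(res_{D_v}|𝔖_v̄(K, W*))`. [cite: GreenbergLNM1716, §5 proof of Prop. 5.8]
[cite: MazurRubin2004, Def. 2.1.1] [cite: Agboola2007, §3, §6] -/
theorem exists_relIndex_selmerGroup_eq_natCard_range_resOfLe [IsTotallyComplex K]
    (e : V.geomPrimaryTorsion p →+ ↥(V.endEigenPrimaryTorsion p π r))
    (he₁ : ∀ x : ↥(V.endEigenPrimaryTorsion p π r), e x = x)
    (he : ∀ (σ : absoluteGaloisGroup K) (x : V.geomPrimaryTorsion p), e (σ • x) = σ • e x)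
    {v vbar : HeightOneSpectrum (𝓞 K)} (hv : ((p : ℕ) : 𝓞 K) ∈ v.asIdeal) (hne : vbar ≠ v)
    (hall : ∀ w : HeightOneSpectrum (𝓞 K), ((p : ℕ) : 𝓞 K) ∈ w.asIdeal → w = v ∨ w = vbar)
    (hfin : Finite (restrictedSelmerBase ↥(V.endEigenPrimaryTorsion p π r) p vbar)) :
    ∃ N₀ : ℕ, 1 ≤ N₀ ∧ ∀ N : ℕ, N₀ ≤ N →
      ∀ (eN : (V.torsionGaloisModule ((p ^ N : ℕ) : ℤ)).toContRepresentation →ⁱL (V.torsionGaloisModule ((p ^ N : ℕ) : ℤ)).toContRepresentation),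
        (∀ y, primaryInclusion V p N (eN y) = (e (primaryInclusion V p N y) : V.geomPrimaryTorsion p)) →
      ∃ 𝓕 : SelmerStructure (V.torsionGaloisModule ((p ^ N : ℕ) : ℤ)),
        (∀ w : InfinitePlace K, 𝓕 (Sum.inl w) = ⊤) ∧
        (∀ w : HeightOneSpectrum (𝓞 K), w ≠ v →
          𝓕 (Sum.inr w) = (galoisCohomology.map ((primaryInclusion V p N).restrictField (w.adicCompletion K)) 1).ker) ∧
        𝓕 (Sum.inr v) = ((galoisCohomology.map ((primaryInclusion V p N).restrictField (v.adicCompletion K)) 1).ker).comap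
          (galoisCohomology.map (eN.restrictField (v.adicCompletion K)) 1) ∧
        𝓕.selmerGroup.relIndex (SelmerStructure.selmerGroup (Function.update 𝓕 (Sum.inr v : Place K) ⊤)) =
          Nat.card ((resOfLe ↥(V.endEigenPrimaryTorsion p π r) (inf_le_left : (⊤ : Subgroup (absoluteGaloisGroup K)) ⊓ decomp v ≤ ⊤)).comp
            (restrictedSelmerBase ↥(V.endEigenPrimaryTorsion p π r) p vbar).subtype).range := by
  obtain ⟨N₀, h1, hN₀⟩ := exists_forall_pow_nsmul_restrictedSelmerBase_eq_zero V p π r vbar hfin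
  refine ⟨N₀, h1, fun N hN eN heN ↦ ?_⟩
  obtain ⟨𝓕, h𝓕inf, h𝓕, h𝓕v⟩ := exists_selmerStructure_relaxedAt V p N v eN
  exact ⟨𝓕, h𝓕inf, h𝓕, h𝓕v, relIndex_selmerGroup_update_top_eq_natCard_range_resOfLe V p π r N e he he₁ eN heN hv hne hall (hN₀ N hN)
    𝓕 h𝓕inf h𝓕 h𝓕v⟩

end Inputs

/-! ## Road α: the S3c frame -/

section Frame

variable {K : Type} [Field K] [NumberField K]

/-- **(P1) ON EVERY S3c FRAME.** For `d ≠ 0`, `C • W = E^{(d)}` (so `j = -3375`), `K` imaginary quadratic with `2 = v v̄` split, `π² = π − 2`,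
`r² = r − 2`, `W* = E[𝔮_r^∞]` and `𝔖_v̄(K, W*)` finite: the CM projector `e : E[2^∞] → W*` (identity on `W*`, zero on `W*′ = E[𝔮_{1−r}^∞]`,
equivariant), a threshold `N₀ ≥ 1`, and for every `N ≥ N₀` a level-`N` shadow `eN` of `e` (its five properties) and an OPTION A‴ torsion structure
`𝓕` on `E[2^N]` with `[H¹_{𝓕[v ↦ ⊤]}(K, E[2^N]) : H¹_𝓕(K, E[2^N])] = #range(res_{D_v}|𝔖_v̄(K, W*))`. [cite: Rubin1999, §2]
[cite: GreenbergLNM1716, §5 proof of Prop. 5.8] [cite: Agboola2007, §6] -/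
theorem exists_relIndex_selmerGroup_eq_natCard_range_resOfLe_of_frame {d : ℤ} (hd0 : d ≠ 0) (W : WeierstrassCurve ℚ) [W.IsElliptic]
    (C : VariableChange ℚ) (hC : C • W = cm7.quadraticTwist (d : ℚ)) (hK : IsImaginaryQuadratic K)
    {v vbar : HeightOneSpectrum (𝓞 K)} (hv : ((2 : ℕ) : 𝓞 K) ∈ v.asIdeal) (hvbar : ((2 : ℕ) : 𝓞 K) ∈ vbar.asIdeal) (hne : vbar ≠ v)
    (π : (W.baseChange K).endRing) (hrel : (π : AddMonoid.End (W.baseChange K).geomPoints) * π = π - 2) {r : ℤ_[2]} (hr : r * r = r - 2)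
    (hfinB : Finite (restrictedSelmerBase ↥((W.baseChange K).endEigenPrimaryTorsion 2 π r) 2 vbar)) :
    ∃ e : (W.baseChange K).geomPrimaryTorsion 2 →+ ↥((W.baseChange K).endEigenPrimaryTorsion 2 π r),
      (∀ x : ↥((W.baseChange K).endEigenPrimaryTorsion 2 π r), e x = x) ∧
      (∀ x ∈ (W.baseChange K).endEigenPrimaryTorsion 2 π (1 - r), e x = 0) ∧
      (∀ (σ : absoluteGaloisGroup K) (x : (W.baseChange K).geomPrimaryTorsion 2), e (σ • x) = σ • e x) ∧
      ∃ N₀ : ℕ, 1 ≤ N₀ ∧ ∀ N : ℕ, N₀ ≤ N →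
        ∃ eN : ((W.baseChange K).torsionGaloisModule ((2 ^ N : ℕ) : ℤ)).toContRepresentation →ⁱL
            ((W.baseChange K).torsionGaloisModule ((2 ^ N : ℕ) : ℤ)).toContRepresentation,
          (∀ y, primaryInclusion (W.baseChange K) 2 N (eN y) =
            (e (primaryInclusion (W.baseChange K) 2 N y) : (W.baseChange K).geomPrimaryTorsion 2)) ∧
          (∀ y, primaryInclusion (W.baseChange K) 2 N y ∈ (W.baseChange K).endEigenPrimaryTorsion 2 π r → eN y = y) ∧
          (∀ y, e (primaryInclusion (W.baseChange K) 2 N y) = 0 → eN y = 0) ∧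
          (∀ y, primaryInclusion (W.baseChange K) 2 N (eN y) ∈ (W.baseChange K).endEigenPrimaryTorsion 2 π r) ∧
          (∀ y, eN (eN y) = eN y) ∧
          ∃ 𝓕 : SelmerStructure ((W.baseChange K).torsionGaloisModule ((2 ^ N : ℕ) : ℤ)),
            (∀ w : InfinitePlace K, 𝓕 (Sum.inl w) = ⊤) ∧
            (∀ w : HeightOneSpectrum (𝓞 K), w ≠ v →
              𝓕 (Sum.inr w) = (galoisCohomology.map ((primaryInclusion (W.baseChange K) 2 N).restrictField (w.adicCompletion K)) 1).ker) ∧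
            𝓕 (Sum.inr v) = ((galoisCohomology.map ((primaryInclusion (W.baseChange K) 2 N).restrictField (v.adicCompletion K)) 1).ker).comap
              (galoisCohomology.map (eN.restrictField (v.adicCompletion K)) 1) ∧
            𝓕.selmerGroup.relIndex (SelmerStructure.selmerGroup (Function.update 𝓕 (Sum.inr v : Place K) ⊤)) =
              Nat.card ((resOfLe ↥((W.baseChange K).endEigenPrimaryTorsion 2 π r)
                (inf_le_left : (⊤ : Subgroup (absoluteGaloisGroup K)) ⊓ decomp v ≤ ⊤)).comp
                (restrictedSelmerBase ↥((W.baseChange K).endEigenPrimaryTorsion 2 π r) 2 vbar).subtype).range := by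
  haveI : Fact (Nat.Prime 2) := ⟨Nat.prime_two⟩
  haveI : IsTotallyComplex K := hK.2
  have hj : W.j = -3375 := j_eq_of_smul_eq_cm7Twist hd0 W C hC
  obtain ⟨θ, hθ⟩ := exists_sq_eq_neg_seven_of_cmEndo_mem_endRing W K hj π hrel
  obtain ⟨e, he₁, he0, -, he⟩ := exists_eigenProjector_two W hj K hθ π hrel hr
  have hall : ∀ w : HeightOneSpectrum (𝓞 K), ((2 : ℕ) : 𝓞 K) ∈ w.asIdeal → w = v ∨ w = vbar :=
    fun w hw ↦ CMPrimes.eq_or_eq_of_two_mem K hK.1 hv hvbar hne hw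
  obtain ⟨N₀, h1, hN₀⟩ := exists_relIndex_selmerGroup_eq_natCard_range_resOfLe (W.baseChange K) 2 π r e he₁ he hv hne hall hfinB
  refine ⟨e, he₁, he0, he, N₀, h1, fun N hN ↦ ?_⟩
  obtain ⟨eN, -, heN, heW, he0N, hmem, hidem⟩ := exists_levelProj (W.baseChange K) 2 π r N e he₁ he
  obtain ⟨𝓕, h𝓕inf, h𝓕, h𝓕v, hidx⟩ := hN₀ N hN eN heN
  exact ⟨eN, heN, heW, he0N, hmem, hidem, 𝓕, h𝓕inf, h𝓕, h𝓕v, hidx⟩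

end Frame

end Summit.BirchSwinnertonDyer.BirchSwinnertonDyer.Theorems.PrintCf2.RestrictedSelmerPair

end
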